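import Summits.Ventures.YMGap.Thresholds.StarWindowBoundSUN
import Summits.Ventures.YMGap.Thresholds.StarTransferZd
import Summits.Ventures.YMGap.Thresholds.StarLemmaGRows
import Literature.MathematicalPhysics.QuantumFieldTheory.Balaban1983to89.StrongCouplingKernelWindow
import Summits.QuantumFields.BalabanUV.InfraRed.StrongCouplingVarianceDoorSUN
import HarnessLib

/-!
# Venture YMGap — track (c) «DS»: the vertex-star rows for EVERY `SU(N)`, `d = 4` — torus clustering
# uniform in the volume, DLR uniqueness on `ℤ⁴`, unique thermodynamic limit (hypothesis-free via the
# Bakry–Émery one-link modulus; one conditional `SU(3)` row on a certified variance inequality)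

HONEST FRAMING: venture file (cell `pub-ymgap`), strong-coupling LATTICE statements (SC-a currency: the
Dobrushin–Shlosman window condition with vertex-star windows ⇒ exponential clustering of link observables of
the torus Wilson measure uniformly in the side, and `|𝒢| = 1` + convergence of the torus states on `ℤ⁴`) for
`SU(N)` lattice Yang–Mills with the Wilson plaquette weight `exp(−β (N − Re tr U_q))`, tree coupling `β ≥ 0`,
't Hooft coupling `x = β/N`; nothing about the continuum, confinement at weak coupling, or the mass gap.
ARITHMETIC over tree theorems, nothing else: the generic-`N` star window `StarLemmaGSUN.star_window_of_*`
(this seat; port of ds-4's Lemma G capstone), the torus door `DSWindow.star_abs_covariance_le`, the `ℤ^d`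
doors `DSWindowZd.hasUniqueGibbsMeasure_of_isLinkWindowContraction` /
`hasUniqueInfiniteVolumeLimit_of_starWindowBoundZd` (ds-1, p329551), the hypothesis-free Bakry–Émery
modulus `oneLinkKRModulus_SU` (`K = 1/(1/2 − 6x)`, Shen–Zhu–Zhu Lemma 4.1), and — for ONE conditional
row — pub-balaban's variance modulus `oneLinkKRModulus_of_varianceBound`.

NUMBERS.  Per-incidence coefficient `c = x/(1/2 − 6x)`; the star door needs `R_G(4c) < 1`, granted by the
tree for `4c ≤ 9/25`, i.e. `x ≤ 9/308 = 0.02922…` — versus the single-site hypothesis-free window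
`x < 1/48 = 0.02083…` of the tree (`dlrMassGapAt_SU`, `strongCouplingFronts_SU`; printed Shen–Zhu–Zhu
`1/(16(d−1))`): `+40 %`, for every `N ≥ 2`, no hypothesis, and TWO-SIDED (`|β|/N ≤ 9/308`: the whole
chain sees only `|β|`, so odd `N` needs no sign-flip symmetry).  In `SU(3)` Wilson units `β_W = 6/g²`
(tree coupling `β_W/3`, 't Hooft `β_W/9`): uniqueness and clustering at every `0 ≤ β_W ≤ 81/308 = 0.2629…`
(tree/printed bar `3/16 = 0.1875`, `su3_dlrMassGapAt_lt`); conditional on the C-iv-certified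
`OneLinkVarianceBound 3 (11/30) (49/20)` (the hypothesis of the tree's `SlabAreaLawVariance` rows): every
`0 ≤ β_W ≤ 21/50 = 0.42`.  For `SU(2)` these rows are superseded by the sharp quarter-modulus rows
(`K = 1`, door `β_W ≤ 9/25`, `StarLemmaGRows` / `StarInfiniteVolume`).
-/

noncomputable section

open MeasureTheory Function Finset ProbabilityTheory
open Literature.Probability.LatticeModels
open Literature.MathematicalPhysics.QuantumLattice (fundamentalRep ymSpecification HasUniqueInfiniteVolumeLimit)
open Literature.MathematicalPhysics.QuantumFieldTheory
open Literature.MathematicalPhysics.QuantumFieldTheory.Balaban1983to89.StrongCouplingDobrushinWindow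
  (OneLinkKRModulus)
open Literature.MathematicalPhysics.QuantumFieldTheory.Balaban1983to89.StrongCouplingTorusWindow
  (wilsonPlaqWeight wilsonMeasure_eq_groupHeatKernelMeasure continuous_wilsonPlaqWeight wilsonPlaqWeight_pos)
open Literature.MathematicalPhysics.QuantumFieldTheory.Balaban1983to89.StrongCouplingKernelWindow
  (oneLinkKRModulus_SU)
open Summit.QuantumFields.BalabanUV.InfraRed.StrongCouplingVarianceDoorSUN
  (OneLinkVarianceBound oneLinkKRModulus_of_varianceBound)
open Summit.Ventures.YMGap.DSWindow
open Summit.Ventures.YMGap.DSWindowZd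
open Summit.Ventures.YMGap.StarWindowGauge (gaugeR Delta_pos gaugeR_lt_one_of_le)
open Summit.Ventures.YMGap.StarLemmaG (Karr gaugeR_nonneg)
open Summit.Ventures.YMGap.StarLemmaGSUN

namespace Summit.Ventures.YMGap.StarSUN

variable {L : ℕ} [NeZero L] {N : ℕ}

/-! ### Small arithmetic -/

omit [NeZero L] in
/-- A one-link modulus with constant `K` is one with any larger constant `K'`. [folklore] -/
theorem oneLinkKRModulus_mono_const {R K K' : ℝ} (h : OneLinkKRModulus N R K) (hKK' : K ≤ K') :
    OneLinkKRModulus N R K' := by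
  intro B B' hB hB' φ Lc hφm hφb hL hφL
  refine (h B B' hB hB' φ Lc hφm hφb hL hφL).trans ?_
  have : 0 ≤ Lc * frobNorm (B - B') := mul_nonneg hL (frobNorm_nonneg _)
  nlinarith

/-! ### The three rows from ANY one-link modulus (`SU(N)`, `d = 4`) -/

/-- **Torus clustering, uniformly in the side, from a one-link modulus.**  `SU(N)` Wilson action on
`(ℤ/L)^4`, `L ≥ 3`, tree coupling `β`; a one-link modulus `OneLinkKRModulus N R K` (`K ≥ 0`) on the tilt
ball `R ≥ 6|β|/N` with `4K|β|/N ≤ 9/25`.  Then for admissible link observables `f, g` whose links'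
endpoints are `≥ L₀` apart in the periodic sup-distance,
`|cov(f,g)| ≤ 4(2√N)² exp(−(1−ρ)² L₀/(2(16ρ+1))) (Σδf)(Σδg)`, `ρ = R_G(4K|β|/N) < 1`, under the torus
Wilson measure — the star door `DSWindow.star_abs_covariance_le` on the generic-`N` window
`StarLemmaGSUN.star_window_of_oneLinkKRModulus`. Constants independent of `L`. [folklore] -/
theorem abs_covariance_le_of_oneLinkKRModulus (hL : 3 ≤ L) (hN : 1 ≤ N) {β R K : ℝ} (hK0 : 0 ≤ K)
    (hR : |β| / N * 6 ≤ R) (hmod : OneLinkKRModulus N R K) (h : 4 * (K * (|β| / N)) ≤ 9 / 25)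
    {f g : GaugeConfig 4 L (Matrix.specialUnitaryGroup (Fin N) ℂ) → ℝ} {Δf Δg : Finset (Edge 4 L)}
    {δf δg : Edge 4 L → ℝ} (hf : LinkObs suFrobDist f Δf δf) (hg : LinkObs suFrobDist g Δg δg)
    (L₀ : ℕ) (hL₀ : ∀ x ∈ Δf, ∀ z ∈ Δg, ∀ a ∈ linkEnds x, ∀ w ∈ linkEnds z, L₀ ≤ torusNorm (a - w)) :
    |cov[f, g; wilsonMeasure (d := 4) (L := L) (fundamentalRep (Fin N)) β]| ≤
      4 * (2 * Real.sqrt N) ^ 2 *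
        Real.exp (-((1 - gaugeR (4 * (K * (|β| / N)))) ^ 2 /
          (2 * (16 * gaugeR (4 * (K * (|β| / N))) + 1)) * L₀)) *
        (∑ x ∈ Δf, δf x) * ∑ y ∈ Δg, δg y := by
  haveI : SecondCountableTopology (Matrix (Fin N) (Fin N) ℂ) :=
    inferInstanceAs (SecondCountableTopology (Fin N → Fin N → ℂ))
  haveI : SecondCountableTopology (Matrix.specialUnitaryGroup (Fin N) ℂ) :=
    Topology.IsEmbedding.subtypeVal.secondCountableTopology
  have hc0 : 0 ≤ K * (|β| / N) := mul_nonneg hK0 (by positivity)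
  have hc6 : K * (|β| / N) < 1 / 6 := by linarith
  obtain ⟨hK, hKloc, hH1, hH2⟩ := star_window_of_oneLinkKRModulus (L := L) hL hN hK0 hR hmod hc6
  have hρ0 : 0 ≤ gaugeR (4 * (K * (|β| / N))) := gaugeR_nonneg (by linarith) (by linarith)
  have hρ1 : gaugeR (4 * (K * (|β| / N))) < 1 := gaugeR_lt_one_of_le (by linarith) h
  rw [wilsonMeasure_eq_groupHeatKernelMeasure]
  have key := star_abs_covariance_le (continuous_wilsonPlaqWeight (N := N) β) (wilsonPlaqWeight_pos (N := N) β)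
    (R := 2 * Real.sqrt N) (by positivity) suFrobDist_le hK hKloc hH1 hρ0 hρ1
    (fun s x hx => (hH2 s x hx).le) hf hg L₀ hL₀
  have e : (2 * gaugeR (4 * (K * (|β| / N))) * ((2 * 4 : ℕ) : ℝ) + 1) =
      16 * gaugeR (4 * (K * (|β| / N))) + 1 := by push_cast; ring
  rw [e] at key
  exact key

/-- Generic-side form of the uniqueness row (the torus side `L ≥ 5` is a dummy: the conclusion lives on
`ℤ⁴`; instantiated at `L = 5` below). [folklore] -/
theorem hasUniqueGibbsMeasure_of_oneLinkKRModulus_side (hL : 5 ≤ L) (hN : 1 ≤ N) {β R K : ℝ}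
    (hK0 : 0 ≤ K) (hR : |β| / N * 6 ≤ R) (hmod : OneLinkKRModulus N R K)
    (h : 4 * (K * (|β| / N)) ≤ 9 / 25) :
    HasUniqueGibbsMeasure (ymSpecification (d := 4) (fundamentalRep (Fin N)) β) := by
  have hc0 : 0 ≤ K * (|β| / N) := mul_nonneg hK0 (by positivity)
  have hc6 : K * (|β| / N) < 1 / 6 := by linarith
  obtain ⟨hK, -, hH1, hH2⟩ := star_window_of_oneLinkKRModulus (L := L) (by omega) hN hK0 hR hmod hc6
  have hρ0 : 0 ≤ gaugeR (4 * (K * (|β| / N))) := gaugeR_nonneg (by linarith) (by linarith)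
  have hρ1 : gaugeR (4 * (K * (|β| / N))) < 1 := gaugeR_lt_one_of_le (by linarith) h
  exact hasUniqueGibbsMeasure_of_isLinkWindowContraction hL hρ0 hρ1 hK hH1
    fun t x hx => (hH2 t x hx).le

/-- Generic-side form of the thermodynamic-limit row (instantiated at `L = 5` below). [folklore] -/
theorem hasUniqueInfiniteVolumeLimit_of_oneLinkKRModulus_side (hL : 5 ≤ L) (hN : 1 ≤ N) {β R K : ℝ}
    (hK0 : 0 ≤ K) (hR : |β| / N * 6 ≤ R) (hmod : OneLinkKRModulus N R K)
    (h : 4 * (K * (|β| / N)) ≤ 9 / 25) :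
    HasUniqueInfiniteVolumeLimit (d := 4) (fundamentalRep (Fin N)) β := by
  have hc0 : 0 ≤ K * (|β| / N) := mul_nonneg hK0 (by positivity)
  have hc6 : K * (|β| / N) < 1 / 6 := by linarith
  obtain ⟨hK, -, hH1, hH2⟩ := star_window_of_oneLinkKRModulus (L := L) (by omega) hN hK0 hR hmod hc6
  have hρ0 : 0 ≤ gaugeR (4 * (K * (|β| / N))) := gaugeR_nonneg (by linarith) (by linarith)
  have hρ1 : gaugeR (4 * (K * (|β| / N))) < 1 := gaugeR_lt_one_of_le (by linarith) h
  exact hasUniqueInfiniteVolumeLimit_of_starWindowBoundZd β hρ0 hρ1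
    (starWindowBoundZd_of_isLinkWindowContraction hL suFrobDist_nonneg hK hH1
      fun t x hx => (hH2 t x hx).le)

omit [NeZero L] in
/-- **DLR uniqueness on `ℤ⁴` from a one-link modulus** (`SU(N)`, any `N ≥ 1`): `OneLinkKRModulus N R K`,
`K ≥ 0`, `R ≥ 6|β|/N`, `4K|β|/N ≤ 9/25` ⇒ the infinite-volume Wilson specification
`ymSpecification (fundamentalRep (Fin N)) β` has exactly one DLR state — the generic-`N` window on the
torus of side `5` fed into `DSWindowZd.hasUniqueGibbsMeasure_of_isLinkWindowContraction` (chart +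
Dobrushin–Shlosman uniqueness door). [folklore] -/
theorem hasUniqueGibbsMeasure_of_oneLinkKRModulus (hN : 1 ≤ N) {β R K : ℝ} (hK0 : 0 ≤ K)
    (hR : |β| / N * 6 ≤ R) (hmod : OneLinkKRModulus N R K) (h : 4 * (K * (|β| / N)) ≤ 9 / 25) :
    HasUniqueGibbsMeasure (ymSpecification (d := 4) (fundamentalRep (Fin N)) β) :=
  hasUniqueGibbsMeasure_of_oneLinkKRModulus_side (L := 5) le_rfl hN hK0 hR hmod h

omit [NeZero L] in
/-- **Unique thermodynamic limit from a one-link modulus** (`SU(N)`): under the same hypotheses the full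
sequence of torus Wilson states converges on bounded continuous cylinder observables and has exactly one
limit point (`HasUniqueInfiniteVolumeLimit`, Osterwalder–Seiler §4 currency) —
`starWindowBoundZd_of_isLinkWindowContraction` + `hasUniqueInfiniteVolumeLimit_of_starWindowBoundZd`.
[folklore] -/
theorem hasUniqueInfiniteVolumeLimit_of_oneLinkKRModulus (hN : 1 ≤ N) {β R K : ℝ} (hK0 : 0 ≤ K)
    (hR : |β| / N * 6 ≤ R) (hmod : OneLinkKRModulus N R K) (h : 4 * (K * (|β| / N)) ≤ 9 / 25) :
    HasUniqueInfiniteVolumeLimit (d := 4) (fundamentalRep (Fin N)) β :=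
  hasUniqueInfiniteVolumeLimit_of_oneLinkKRModulus_side (L := 5) le_rfl hN hK0 hR hmod h

/-! ### Hypothesis-free rows for every `SU(N)`, `N ≥ 2` (Bakry–Émery modulus) -/

omit [NeZero L] in
/-- The Bakry–Émery coefficient, two-sided form: for `|β|/N ≤ 9/308`, with `K = 1/(1/2 − 6|β|/N)` one has
`6|β|/N < 1/2`, `K ≥ 0` and `4K(|β|/N) ≤ 9/25` (equality at `9/308`). [folklore] -/
theorem bakryEmery_coef_le_abs {β : ℝ} (hN : 1 ≤ N) (h : |β| / N ≤ 9 / 308) :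
    |β| / N * 6 < 1 / 2 ∧ 0 ≤ 1 / (1 / 2 - |β| / N * 6) ∧
      4 * (1 / (1 / 2 - |β| / N * 6) * (|β| / N)) ≤ 9 / 25 := by
  have hN0 : (0 : ℝ) < N := by exact_mod_cast (show 0 < N by omega)
  have hx0 : 0 ≤ |β| / N := div_nonneg (abs_nonneg β) hN0.le
  have h1 : |β| / N * 6 < 1 / 2 := by linarith
  have hpos : 0 < 1 / 2 - |β| / N * 6 := by linarith
  refine ⟨h1, (one_div_pos.2 hpos).le, ?_⟩
  rw [show 4 * (1 / (1 / 2 - |β| / N * 6) * (|β| / N)) = (4 * (|β| / N)) / (1 / 2 - |β| / N * 6) by ring,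
    div_le_iff₀ hpos]
  linarith

omit [NeZero L] in
/-- The Bakry–Émery coefficient: for `0 ≤ β` and `β/N ≤ 9/308`, with `K = 1/(1/2 − 6β/N)` one has `K ≥ 0`,
`6β/N < 1/2` and `4K(β/N) ≤ 9/25`. [folklore] -/
theorem bakryEmery_coef_le {β : ℝ} (hN : 1 ≤ N) (h0 : 0 ≤ β) (h : β / N ≤ 9 / 308) :
    |β| / N * 6 < 1 / 2 ∧ 0 ≤ 1 / (1 / 2 - |β| / N * 6) ∧
      4 * (1 / (1 / 2 - |β| / N * 6) * (|β| / N)) ≤ 9 / 25 :=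
  bakryEmery_coef_le_abs hN (by rwa [abs_of_nonneg h0])

omit [NeZero L] in
/-- **DLR UNIQUENESS FOR EVERY `SU(N)`, `N ≥ 2`, `d = 4`, HYPOTHESIS-FREE, TWO-SIDED**: at every tree coupling
`β` with `|β|/N ≤ 9/308 = 0.02922…` ('t Hooft; DERIVED here) the `SU(N)` lattice Yang–Mills specification on
`ℤ⁴` has exactly one DLR state — the star window with the Bakry–Émery modulus `oneLinkKRModulus_SU`
(`K = 1/(1/2 − 6|β|/N)`; the whole chain only ever sees `|β|`, so no sign-flip symmetry is needed and odd `N`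
is covered).  For comparison (each in its own class): PRINTED Shen–Zhu–Zhu window `|β|/N < 1/(16(d−1)) = 1/48`
(= the tree's hypothesis-free single-site row `dlrMassGapAt_SU`); the cell's track-(a) Bakry–Émery threshold
`1/(8d) = 1/32`, conditional on three printed facts (`improvedThreshold_sharp`). [folklore] -/
theorem hasUniqueGibbsMeasure_abs (hN : 2 ≤ N) {β : ℝ} (h : |β| / N ≤ 9 / 308) :
    HasUniqueGibbsMeasure (ymSpecification (d := 4) (fundamentalRep (Fin N)) β) := by
  obtain ⟨h1, hK0, h4⟩ := bakryEmery_coef_le_abs (by omega) h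
  exact hasUniqueGibbsMeasure_of_oneLinkKRModulus (by omega) hK0 le_rfl (oneLinkKRModulus_SU hN h1) h4

omit [NeZero L] in
/-- **UNIQUE THERMODYNAMIC LIMIT FOR EVERY `SU(N)`, `N ≥ 2`, `d = 4`, HYPOTHESIS-FREE, TWO-SIDED**: at every tree
coupling `β` with `|β|/N ≤ 9/308` the torus Wilson states converge along the full sequence of sides to the unique
DLR state. [folklore] -/
theorem hasUniqueInfiniteVolumeLimit_abs (hN : 2 ≤ N) {β : ℝ} (h : |β| / N ≤ 9 / 308) :
    HasUniqueInfiniteVolumeLimit (d := 4) (fundamentalRep (Fin N)) β := by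
  obtain ⟨h1, hK0, h4⟩ := bakryEmery_coef_le_abs (by omega) h
  exact hasUniqueInfiniteVolumeLimit_of_oneLinkKRModulus (by omega) hK0 le_rfl (oneLinkKRModulus_SU hN h1) h4

omit [NeZero L] in
/-- **DLR UNIQUENESS FOR EVERY `SU(N)`, `N ≥ 2`, `d = 4`, HYPOTHESIS-FREE**: at every tree coupling
`0 ≤ β` with `β/N ≤ 9/308 = 0.02922…` ('t Hooft; DERIVED here), the `SU(N)` lattice Yang–Mills
specification on `ℤ⁴` has exactly one DLR state — the star window with the Bakry–Émery modulus
`oneLinkKRModulus_SU` (`K = 1/(1/2 − 6β/N)`).  For comparison (each in its own class): PRINTED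
Shen–Zhu–Zhu window `β/N < 1/(16(d−1)) = 1/48 = 0.02083…` (= the tree's hypothesis-free single-site row
`dlrMassGapAt_SU`); the cell's track-(a) Bakry–Émery threshold `1/(8d) = 1/32`, conditional on three
printed facts (`improvedThreshold_sharp`). One-sided instance of `hasUniqueGibbsMeasure_abs`. [folklore] -/
theorem hasUniqueGibbsMeasure (hN : 2 ≤ N) {β : ℝ} (h0 : 0 ≤ β) (h : β / N ≤ 9 / 308) :
    HasUniqueGibbsMeasure (ymSpecification (d := 4) (fundamentalRep (Fin N)) β) :=
  hasUniqueGibbsMeasure_abs hN (by rwa [abs_of_nonneg h0])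

omit [NeZero L] in
/-- **UNIQUE THERMODYNAMIC LIMIT FOR EVERY `SU(N)`, `N ≥ 2`, `d = 4`, HYPOTHESIS-FREE**: at every tree
coupling `0 ≤ β`, `β/N ≤ 9/308`, the torus Wilson states converge along the full sequence of sides to the
unique DLR state. One-sided instance of `hasUniqueInfiniteVolumeLimit_abs`. [folklore] -/
theorem hasUniqueInfiniteVolumeLimit (hN : 2 ≤ N) {β : ℝ} (h0 : 0 ≤ β) (h : β / N ≤ 9 / 308) :
    HasUniqueInfiniteVolumeLimit (d := 4) (fundamentalRep (Fin N)) β :=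
  hasUniqueInfiniteVolumeLimit_abs hN (by rwa [abs_of_nonneg h0])

/-- **TORUS CLUSTERING FOR EVERY `SU(N)`, `N ≥ 2`, `d = 4`, HYPOTHESIS-FREE, uniformly in the side `L ≥ 3`**:
at every tree coupling `0 ≤ β`, `β/N ≤ 9/308`, admissible link observables whose links' endpoints are
`≥ L₀` apart satisfy `|cov(f,g)| ≤ 16N exp(−(1−ρ)² L₀/(2(16ρ+1))) (Σδf)(Σδg)` with
`ρ = R_G(4(β/N)/(1/2 − 6β/N)) < 1`, under the torus Wilson measure. [folklore] -/
theorem abs_covariance_le (hL : 3 ≤ L) (hN : 2 ≤ N) {β : ℝ} (h0 : 0 ≤ β) (h : β / N ≤ 9 / 308)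
    {f g : GaugeConfig 4 L (Matrix.specialUnitaryGroup (Fin N) ℂ) → ℝ} {Δf Δg : Finset (Edge 4 L)}
    {δf δg : Edge 4 L → ℝ} (hf : LinkObs suFrobDist f Δf δf) (hg : LinkObs suFrobDist g Δg δg)
    (L₀ : ℕ) (hL₀ : ∀ x ∈ Δf, ∀ z ∈ Δg, ∀ a ∈ linkEnds x, ∀ w ∈ linkEnds z, L₀ ≤ torusNorm (a - w)) :
    |cov[f, g; wilsonMeasure (d := 4) (L := L) (fundamentalRep (Fin N)) β]| ≤
      4 * (2 * Real.sqrt N) ^ 2 *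
        Real.exp (-((1 - gaugeR (4 * (1 / (1 / 2 - |β| / N * 6) * (|β| / N)))) ^ 2 /
          (2 * (16 * gaugeR (4 * (1 / (1 / 2 - |β| / N * 6) * (|β| / N))) + 1)) * L₀)) *
        (∑ x ∈ Δf, δf x) * ∑ y ∈ Δg, δg y := by
  obtain ⟨h1, hK0, h4⟩ := bakryEmery_coef_le (by omega) h0 h
  exact abs_covariance_le_of_oneLinkKRModulus hL (by omega) hK0 le_rfl (oneLinkKRModulus_SU hN h1) h4
    hf hg L₀ hL₀

omit [NeZero L] in
/-- 't Hooft form: for `N ≥ 2` and every `0 ≤ x ≤ 9/308`, `|𝒢| = 1` for the `SU(N)` specification at tree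
coupling `N·x` (the coupling convention of the tree's `DLRMassGapAt 4 N x`). [folklore] -/
theorem hasUniqueGibbsMeasure_thooft (hN : 2 ≤ N) {x : ℝ} (h0 : 0 ≤ x) (h : x ≤ 9 / 308) :
    HasUniqueGibbsMeasure (ymSpecification (d := 4) (fundamentalRep (Fin N)) (N * x)) := by
  have hN0 : (0 : ℝ) < N := by exact_mod_cast (show 0 < N by omega)
  refine hasUniqueGibbsMeasure hN (mul_nonneg hN0.le h0) ?_
  rwa [mul_div_cancel_left₀ _ hN0.ne']

omit [NeZero L] in
/-- The numbers side by side: the star door `9/308` against the single-site door `1/48` ('t Hooft units):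
`1/48 < 9/308`, ratio `108/77 = 1.4026…`. [folklore] -/
theorem door_numbers : (1 : ℝ) / 48 < 9 / 308 ∧ (9 : ℝ) / 308 / (1 / 48) = 108 / 77 := by norm_num

/-! ### `SU(3)` in Wilson units `β_W = 6/g²` (tree coupling `β_W/3`, 't Hooft `β_W/9`) -/

omit [NeZero L] in
/-- **`SU(3)`: DLR uniqueness at every `0 ≤ β_W ≤ 81/308 = 0.2629…`, hypothesis-free** (DERIVED here;
for comparison, each in its own currency/class: the printed Shen–Zhu–Zhu window = the tree's hypothesis-free
single-site SC-a bar `β_W < 3/16 = 0.1875` (`su3_dlrMassGapAt_lt`); `pub-balaban`'s hypothesis-free SC-b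
`4500/20223 = 0.2225…` and SC-c `9/40` (`su3_strongCouplingFronts_v1`, different statements)). [folklore] -/
theorem su3_hasUniqueGibbsMeasure_le {βW : ℝ} (h0 : 0 ≤ βW) (h : βW ≤ 81 / 308) :
    HasUniqueGibbsMeasure (ymSpecification (d := 4) (fundamentalRep (Fin 3)) (βW / 3)) :=
  hasUniqueGibbsMeasure (N := 3) (by norm_num) (by positivity) (by push_cast; linarith)

omit [NeZero L] in
/-- **`SU(3)`: unique thermodynamic limit at every `0 ≤ β_W ≤ 81/308`, hypothesis-free.** [folklore] -/
theorem su3_hasUniqueInfiniteVolumeLimit_le {βW : ℝ} (h0 : 0 ≤ βW) (h : βW ≤ 81 / 308) :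
    HasUniqueInfiniteVolumeLimit (d := 4) (fundamentalRep (Fin 3)) (βW / 3) :=
  hasUniqueInfiniteVolumeLimit (N := 3) (by norm_num) (by positivity) (by push_cast; linarith)

omit [NeZero L] in
/-- **`SU(3)`, two-sided: DLR uniqueness at every `|β_W| ≤ 81/308`, hypothesis-free** (no sign-flip symmetry is
used — none exists for odd `N`; the star window sees only `|β|`). [folklore] -/
theorem su3_hasUniqueGibbsMeasure_abs_le {βW : ℝ} (h : |βW| ≤ 81 / 308) :
    HasUniqueGibbsMeasure (ymSpecification (d := 4) (fundamentalRep (Fin 3)) (βW / 3)) :=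
  hasUniqueGibbsMeasure_abs (N := 3) (by norm_num) (by
    rw [abs_div, abs_of_pos (by norm_num : (0 : ℝ) < 3)]; push_cast; linarith)

omit [NeZero L] in
/-- **`SU(3)`, two-sided: unique thermodynamic limit at every `|β_W| ≤ 81/308`, hypothesis-free.** [folklore] -/
theorem su3_hasUniqueInfiniteVolumeLimit_abs_le {βW : ℝ} (h : |βW| ≤ 81 / 308) :
    HasUniqueInfiniteVolumeLimit (d := 4) (fundamentalRep (Fin 3)) (βW / 3) :=
  hasUniqueInfiniteVolumeLimit_abs (N := 3) (by norm_num) (by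
    rw [abs_div, abs_of_pos (by norm_num : (0 : ℝ) < 3)]; push_cast; linarith)

omit [NeZero L] in
/-- Instance: **`SU(3)` DLR uniqueness at `β_W = 1/4`** (`g² = 24`), hypothesis-free. [folklore] -/
theorem su3_hasUniqueGibbsMeasure_quarter :
    HasUniqueGibbsMeasure (ymSpecification (d := 4) (fundamentalRep (Fin 3)) ((1 / 4 : ℝ) / 3)) :=
  su3_hasUniqueGibbsMeasure_le (by norm_num) (by norm_num)

omit [NeZero L] in
/-- **`SU(3)`, CONDITIONAL ROW: DLR uniqueness at every `0 ≤ β_W ≤ 21/50 = 0.42`** given the one-link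
variance inequality `OneLinkVarianceBound 3 (11/30) (49/20)` — a finite-dimensional inequality NOT proved
here, certified as a computation (class «C-iv modulo CERT-SPEC-sigma1-v2», two engines of the cell
`pub-balaban`, replayed by `pub-ymgap`), the displayed hypothesis of the tree's `SlabAreaLawVariance` rows;
so this row is «K × C-iv», not K.  The variance modulus `oneLinkKRModulus_of_varianceBound` on the ball
`R = 7/25 ≥ 2β_W/3` has `K = √((49/20)/(3·(1/2 − 7/25))) ≤ 27/14`, and `4·(27/14)·(β_W/9) ≤ 9/25` iff
`β_W ≤ 21/50` (derived here; no printed counterpart; the hypothesis-free row above stops at `81/308`).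
[folklore] -/
theorem su3_hasUniqueGibbsMeasure_le_of_varianceBound (hv : OneLinkVarianceBound 3 (11 / 30) (49 / 20))
    {βW : ℝ} (h0 : 0 ≤ βW) (h : βW ≤ 21 / 50) :
    HasUniqueGibbsMeasure (ymSpecification (d := 4) (fundamentalRep (Fin 3)) (βW / 3)) := by
  have hv' : OneLinkVarianceBound 3 (7 / 25) (49 / 20) := hv.mono (by norm_num) le_rfl
  have hmod := oneLinkKRModulus_of_varianceBound (N := 3) (by norm_num) (R := 7 / 25) (by norm_num)
    (by norm_num) hv'
  have hK : Real.sqrt (49 / 20 / ((3 : ℕ) * (1 / 2 - 7 / 25))) ≤ 27 / 14 := by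
    rw [Real.sqrt_le_left (by norm_num)]
    norm_num
  have hmod' : OneLinkKRModulus 3 (7 / 25) (27 / 14) := oneLinkKRModulus_mono_const hmod hK
  refine hasUniqueGibbsMeasure_of_oneLinkKRModulus (N := 3) (by norm_num) (by norm_num) ?_ hmod' ?_
  · rw [abs_of_nonneg (by positivity)]; push_cast; linarith
  · rw [abs_of_nonneg (by positivity)]; push_cast; linarith

omit [NeZero L] in
/-- **`SU(3)`, CONDITIONAL ROW: unique thermodynamic limit at every `0 ≤ β_W ≤ 21/50`** given
`OneLinkVarianceBound 3 (11/30) (49/20)` (class «K × C-iv modulo CERT-SPEC-sigma1-v2», as above). [folklore] -/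
theorem su3_hasUniqueInfiniteVolumeLimit_le_of_varianceBound
    (hv : OneLinkVarianceBound 3 (11 / 30) (49 / 20)) {βW : ℝ} (h0 : 0 ≤ βW) (h : βW ≤ 21 / 50) :
    HasUniqueInfiniteVolumeLimit (d := 4) (fundamentalRep (Fin 3)) (βW / 3) := by
  have hv' : OneLinkVarianceBound 3 (7 / 25) (49 / 20) := hv.mono (by norm_num) le_rfl
  have hmod := oneLinkKRModulus_of_varianceBound (N := 3) (by norm_num) (R := 7 / 25) (by norm_num)
    (by norm_num) hv'
  have hK : Real.sqrt (49 / 20 / ((3 : ℕ) * (1 / 2 - 7 / 25))) ≤ 27 / 14 := by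
    rw [Real.sqrt_le_left (by norm_num)]
    norm_num
  have hmod' : OneLinkKRModulus 3 (7 / 25) (27 / 14) := oneLinkKRModulus_mono_const hmod hK
  refine hasUniqueInfiniteVolumeLimit_of_oneLinkKRModulus (N := 3) (by norm_num) (by norm_num) ?_ hmod' ?_
  · rw [abs_of_nonneg (by positivity)]; push_cast; linarith
  · rw [abs_of_nonneg (by positivity)]; push_cast; linarith

end Summit.Ventures.YMGap.StarSUN

end
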